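import Mathlib
import Summits.NavierStokesRegularity.NavierStokesRegularity.Theorems.EulerZoomLiouvillePowerGaugeEulerLiouvilleGalileanFrameShear
import Literature.Analysis.FluidPDE.WeakGradientIBP
import HarnessLib

/-!
# RIGID FRAMES: the space–time rigid shear `(τ, x) ↦ (τ, R(τ)⁻¹(x − ξ(τ)))` — slab integrals and integrability
# (crux `EulerZoomLiouville.PowerGaugeEulerLiouville` = stmt-NavierStokesRegularity-19832; tools of the «E(3)-steady, escaping» stratum; width seat ns-ezl-w3 g5)

Route №10 `EulerZoomLiouville` (NavierStokesRegularity), crux E.  Rotational twin of `…GalileanFrameShear.lean` (F1e tools I): for a rigid-frame-steady member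
`u(τ, x) = R(τ) U(R(τ)⁻¹(x − ξ(τ)))` the space–time integrals of the weak Euler identities are pulled back to the BODY FRAME `w = R(τ)⁻¹(x − ξ(τ))`.
`R, R⁻¹ : ℝ → L(ℝ³)` are continuous paths of mutually inverse linear isometries (`‖R(τ)w‖ = ‖w‖`), `ξ` is continuous.

* `RigidFrame.measurePreserving_isometry_clm` — a norm-preserving invertible `L ∈ L(ℝ³)` preserves Lebesgue measure;
* `RigidFrame.measurableEmbedding_rigidShear`, `RigidFrame.measurePreserving_rigidShear` — the rigid shear is a measure-preserving automorphism of
  space–time (`MeasurePreserving.skew_product`, slice by slice);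
* `RigidFrame.setIntegral_slab_rigid_eq` — `∫∫_{(−∞,0)×ℝ³} F(τ, R(τ)⁻¹(x − ξ(τ))) = ∫ (∫ F(τ, w) dw) dτ` for integrable `F` vanishing for `τ ≥ 0`;
* `RigidFrame.integrable_rigid_linear / _quadratic` — integrability of `χ(τ)⟪R(τ)U(w), G(R(τ)w + ξ(τ))⟫` and `χ(τ)⟪R(τ)U(w), Ψ(R(τ)w + ξ(τ)) R(τ)U(w)⟫`
  on space–time; `RigidFrame.integrable_inner_rigid / _clm_rigid_self` — the slices.

WHAT THIS IS NOT: not NS regularity, not the crux E — tools toward one more symmetry stratum of the crux CLASS 19832 (MODEL lattice; E/NS strata),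
`--supports` stmt-19832; 19832 OPEN. [folklore]
-/

noncomputable section

-- flat `Theorems/<Route><Decl>…` files of one crux share the namespace of the crux (tree convention: `Summit.<S>.<S>.…`)
set_option linter.dupNamespace false

open MeasureTheory Set Filter Topology Metric Function TopologicalSpace InnerProductSpace
open scoped ENNReal NNReal RealInnerProductSpace ContDiff

namespace Summit.NavierStokesRegularity.NavierStokesRegularity.Theorems.PowerGaugeEulerLiouville

namespace RigidFrame

open Literature.Analysis Literature.Analysis.FunctionSpaces Literature.Analysis.FluidPDE
open Summit.NavierStokesRegularity.NavierStokesRegularity.Theorems.PowerGaugeEulerLiouville.GalileanFrames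

variable {U : EuclideanSpace ℝ (Fin 3) → EuclideanSpace ℝ (Fin 3)} {ξ : ℝ → EuclideanSpace ℝ (Fin 3)}
  {R Rinv : ℝ → EuclideanSpace ℝ (Fin 3) →L[ℝ] EuclideanSpace ℝ (Fin 3)}

/-! ### Isometries and the rigid shear -/

/-- A norm-preserving continuous linear map of `ℝ³` with a two-sided inverse preserves Lebesgue measure. [folklore] -/
theorem measurePreserving_isometry_clm {L Linv : EuclideanSpace ℝ (Fin 3) →L[ℝ] EuclideanSpace ℝ (Fin 3)}
    (hL : ∀ w, ‖L w‖ = ‖w‖) (h1 : ∀ x, L (Linv x) = x) (h2 : ∀ w, Linv (L w) = w) :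
    MeasurePreserving (fun w : EuclideanSpace ℝ (Fin 3) => L w) volume volume := by
  let e : EuclideanSpace ℝ (Fin 3) ≃ₗᵢ[ℝ] EuclideanSpace ℝ (Fin 3) :=
    { toLinearEquiv :=
        { toFun := L, invFun := Linv, map_add' := fun x y => map_add L x y, map_smul' := fun c x => map_smul L c x,
          left_inv := h2, right_inv := h1 }
      norm_map' := hL }
  exact e.measurePreserving

/-- The rigid shear `(τ, x) ↦ (τ, R(τ)⁻¹(x − ξ(τ)))` is a measurable embedding (a measurable automorphism with inverse `(τ, w) ↦ (τ, R(τ)w + ξ(τ))`). [folklore] -/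
theorem measurableEmbedding_rigidShear (hR : Continuous R) (hRinv : Continuous Rinv) (hξ : Measurable ξ)
    (h1 : ∀ τ x, R τ (Rinv τ x) = x) (h2 : ∀ τ w, Rinv τ (R τ w) = w) :
    MeasurableEmbedding (fun z : ℝ × EuclideanSpace ℝ (Fin 3) => (z.1, Rinv z.1 (z.2 - ξ z.1))) :=
  have hm1 : Measurable fun z : ℝ × EuclideanSpace ℝ (Fin 3) => Rinv z.1 (z.2 - ξ z.1) :=
    ((hRinv.comp continuous_fst).clm_apply continuous_snd).measurable.comp
      (measurable_fst.prodMk (measurable_snd.sub (hξ.comp measurable_fst)))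
  have hm2 : Measurable fun z : ℝ × EuclideanSpace ℝ (Fin 3) => R z.1 z.2 + ξ z.1 :=
    ((hR.comp continuous_fst).clm_apply continuous_snd).measurable.add (hξ.comp measurable_fst)
  let e : ℝ × EuclideanSpace ℝ (Fin 3) ≃ᵐ ℝ × EuclideanSpace ℝ (Fin 3) :=
    { toFun := fun z => (z.1, Rinv z.1 (z.2 - ξ z.1))
      invFun := fun z => (z.1, R z.1 z.2 + ξ z.1)
      left_inv := fun z => by simp [h1]
      right_inv := fun z => by simp [h2]
      measurable_toFun := measurable_fst.prodMk hm1
      measurable_invFun := measurable_fst.prodMk hm2 }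
  e.measurableEmbedding

/-- **The rigid shear preserves space–time Lebesgue measure** (each slice `x ↦ R(τ)⁻¹(x − ξ(τ))` is a rigid motion). [folklore] -/
theorem measurePreserving_rigidShear (hRinv : Continuous Rinv) (hξ : Measurable ξ)
    (hRi : ∀ τ w, ‖R τ w‖ = ‖w‖) (h1 : ∀ τ x, R τ (Rinv τ x) = x) (h2 : ∀ τ w, Rinv τ (R τ w) = w) :
    MeasurePreserving (fun z : ℝ × EuclideanSpace ℝ (Fin 3) => (z.1, Rinv z.1 (z.2 - ξ z.1)))
      ((volume : Measure ℝ).prod (volume : Measure (EuclideanSpace ℝ (Fin 3))))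
      ((volume : Measure ℝ).prod (volume : Measure (EuclideanSpace ℝ (Fin 3)))) := by
  have hRinvi : ∀ τ x, ‖Rinv τ x‖ = ‖x‖ := fun τ x => by rw [← hRi τ (Rinv τ x), h1]
  have hslice : ∀ τ : ℝ, MeasurePreserving (fun x : EuclideanSpace ℝ (Fin 3) => Rinv τ (x - ξ τ)) volume volume := fun τ =>
    (measurePreserving_isometry_clm (hRinvi τ) (h2 τ) (h1 τ)).comp (measurePreserving_sub_right volume (ξ τ))
  have hm : Measurable fun z : ℝ × EuclideanSpace ℝ (Fin 3) => Rinv z.1 (z.2 - ξ z.1) :=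
    ((hRinv.comp continuous_fst).clm_apply continuous_snd).measurable.comp
      (measurable_fst.prodMk (measurable_snd.sub (hξ.comp measurable_fst)))
  have h := MeasurePreserving.skew_product (μa := (volume : Measure ℝ)) (μb := (volume : Measure ℝ))
    (μc := (volume : Measure (EuclideanSpace ℝ (Fin 3)))) (μd := (volume : Measure (EuclideanSpace ℝ (Fin 3))))
    (f := id) (MeasurePreserving.id volume) (g := fun τ x => Rinv τ (x - ξ τ)) hm
    (Eventually.of_forall fun τ => (hslice τ).map_eq)
  simpa using h

/-- **Slab integrals in the body frame.**  For an integrable frame integrand `F(τ, w)` vanishing for `τ ≥ 0`,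
`∫∫_{(−∞,0)×ℝ³} F(τ, R(τ)⁻¹(x − ξ(τ))) = ∫ (∫ F(τ, w) dw) dτ`. [folklore] -/
theorem setIntegral_slab_rigid_eq (hR : Continuous R) (hRinv : Continuous Rinv) (hξ : Measurable ξ)
    (hRi : ∀ τ w, ‖R τ w‖ = ‖w‖) (h1 : ∀ τ x, R τ (Rinv τ x) = x) (h2 : ∀ τ w, Rinv τ (R τ w) = w)
    {F : ℝ → EuclideanSpace ℝ (Fin 3) → ℝ} (hF0 : ∀ τ : ℝ, 0 ≤ τ → ∀ z, F τ z = 0)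
    (hFi : Integrable (uncurry F) ((volume : Measure ℝ).prod (volume : Measure (EuclideanSpace ℝ (Fin 3))))) :
    ∫ z in Iio (0 : ℝ) ×ˢ (univ : Set (EuclideanSpace ℝ (Fin 3))), F z.1 (Rinv z.1 (z.2 - ξ z.1)) = ∫ τ, ∫ w, F τ w := by
  have e1 : ∫ z in Iio (0 : ℝ) ×ˢ (univ : Set (EuclideanSpace ℝ (Fin 3))), F z.1 (Rinv z.1 (z.2 - ξ z.1)) =
      ∫ z : ℝ × EuclideanSpace ℝ (Fin 3), F z.1 (Rinv z.1 (z.2 - ξ z.1)) := by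
    refine setIntegral_eq_integral_of_forall_compl_eq_zero fun z hz => ?_
    have hz' : ¬ z.1 < 0 := fun h => hz ⟨h, mem_univ _⟩
    exact hF0 z.1 (not_lt.1 hz') _
  have e2 : ∫ z : ℝ × EuclideanSpace ℝ (Fin 3), F z.1 (Rinv z.1 (z.2 - ξ z.1)) =
      ∫ z : ℝ × EuclideanSpace ℝ (Fin 3), uncurry F z ∂((volume : Measure ℝ).prod volume) := by
    rw [Measure.volume_eq_prod]
    exact (measurePreserving_rigidShear hRinv hξ hRi h1 h2).integral_comp
      (measurableEmbedding_rigidShear hR hRinv hξ h1 h2) (uncurry F)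
  rw [e1, e2, integral_prod _ hFi]
  rfl

/-! ### Integrability of the body-frame integrands -/

/-- **Integrability of the linear body-frame integrand** `(τ, w) ↦ χ(τ) ⟪R(τ)U(w), G(R(τ)w + ξ(τ))⟫`. [folklore] -/
theorem integrable_rigid_linear (hU : LocallyIntegrable U volume) (hξ : Continuous ξ) (hR : Continuous R)
    (hRi : ∀ τ w, ‖R τ w‖ = ‖w‖)
    {χ : ℝ → ℝ} (hχ : Continuous χ) (hχc : HasCompactSupport χ)
    {G : EuclideanSpace ℝ (Fin 3) → EuclideanSpace ℝ (Fin 3)} (hG : Continuous G) (hGc : HasCompactSupport G) :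
    Integrable (uncurry fun τ w => χ τ * ⟪R τ (U w), G (R τ w + ξ τ)⟫)
      ((volume : Measure ℝ).prod (volume : Measure (EuclideanSpace ℝ (Fin 3)))) := by
  obtain ⟨T, Cχ, hCχ0, hCχ, hχT⟩ := exists_bound_Icc_of_hasCompactSupport hχ hχc
  obtain ⟨CG, hCG⟩ := hG.bounded_above_of_compact_support hGc
  have hCG0 : 0 ≤ CG := (norm_nonneg _).trans (hCG 0)
  obtain ⟨R₀, hR₀⟩ := hGc.isCompact.isBounded.subset_closedBall (0 : EuclideanSpace ℝ (Fin 3))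
  obtain ⟨M, hM⟩ := (isCompact_Icc (a := -T) (b := T)).exists_bound_of_continuousOn hξ.continuousOn
  set K : Set (EuclideanSpace ℝ (Fin 3)) := closedBall 0 (R₀ + M) with hK
  have hKc : IsCompact K := isCompact_closedBall _ _
  set bound : ℝ × EuclideanSpace ℝ (Fin 3) → ℝ := fun p =>
    (Icc (-T) T).indicator (fun _ => Cχ) p.1 * K.indicator (fun z => CG * ‖U z‖) p.2 with hbound
  have hbi : Integrable bound ((volume : Measure ℝ).prod (volume : Measure (EuclideanSpace ℝ (Fin 3)))) := by
    refine Integrable.mul_prod ?_ ?_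
    · rw [integrable_indicator_iff measurableSet_Icc]
      exact integrableOn_const (by rw [Real.volume_Icc]; exact ENNReal.ofReal_ne_top)
    · rw [integrable_indicator_iff hKc.measurableSet]
      exact ((hU.integrableOn_isCompact hKc).norm.const_mul CG)
  have hmeas : AEStronglyMeasurable (uncurry fun τ w => χ τ * ⟪R τ (U w), G (R τ w + ξ τ)⟫)
      ((volume : Measure ℝ).prod (volume : Measure (EuclideanSpace ℝ (Fin 3)))) := by
    have h1 : AEStronglyMeasurable (fun p : ℝ × EuclideanSpace ℝ (Fin 3) => U p.2)
        ((volume : Measure ℝ).prod (volume : Measure (EuclideanSpace ℝ (Fin 3)))) := hU.aestronglyMeasurable.comp_snd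
    have h1' : AEStronglyMeasurable (fun p : ℝ × EuclideanSpace ℝ (Fin 3) => R p.1 (U p.2))
        ((volume : Measure ℝ).prod (volume : Measure (EuclideanSpace ℝ (Fin 3)))) :=
      (isBoundedBilinearMap_apply (𝕜 := ℝ) (E := EuclideanSpace ℝ (Fin 3)) (F := EuclideanSpace ℝ (Fin 3))).continuous
        |>.comp_aestronglyMeasurable ((hR.comp continuous_fst).aestronglyMeasurable.prodMk h1)
    have h2 : Continuous fun p : ℝ × EuclideanSpace ℝ (Fin 3) => G (R p.1 p.2 + ξ p.1) :=
      hG.comp (((hR.comp continuous_fst).clm_apply continuous_snd).add (hξ.comp continuous_fst))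
    exact ((hχ.comp continuous_fst).aestronglyMeasurable).mul (h1'.inner h2.aestronglyMeasurable)
  refine hbi.mono' hmeas (Eventually.of_forall fun p => ?_)
  simp only [uncurry, hbound]
  by_cases hτ : χ p.1 = 0
  · rw [hτ, zero_mul, norm_zero]
    exact mul_nonneg (indicator_nonneg (fun _ _ => hCχ0) _)
      (indicator_nonneg (fun z _ => mul_nonneg hCG0 (norm_nonneg _)) _)
  have hτI : p.1 ∈ Icc (-T) T := hχT p.1 hτ
  rw [indicator_of_mem hτI]
  by_cases hz : p.2 ∈ K
  · rw [indicator_of_mem hz, norm_mul]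
    refine mul_le_mul (hCχ _) ?_ (norm_nonneg _) hCχ0
    calc ‖⟪R p.1 (U p.2), G (R p.1 p.2 + ξ p.1)⟫‖ ≤ ‖R p.1 (U p.2)‖ * ‖G (R p.1 p.2 + ξ p.1)‖ := norm_inner_le_norm _ _
      _ ≤ ‖U p.2‖ * CG := by rw [hRi]; gcongr; exact hCG _
      _ = CG * ‖U p.2‖ := mul_comm _ _
  · have hG0 : G (R p.1 p.2 + ξ p.1) = 0 := by
      by_contra hne
      have h1 : ‖R p.1 p.2 + ξ p.1‖ ≤ R₀ := mem_closedBall_zero_iff.1 (hR₀ (subset_tsupport _ (mem_support.2 hne)))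
      have h2 : ‖R p.1 p.2‖ ≤ ‖R p.1 p.2 + ξ p.1‖ + ‖ξ p.1‖ := norm_le_add_norm_add _ _
      rw [hRi] at h2
      exact hz (mem_closedBall_zero_iff.2 (by linarith [hM p.1 hτI]))
    rw [hG0, inner_zero_right, mul_zero, norm_zero, indicator_of_notMem hz, mul_zero]

/-- **Integrability of the quadratic body-frame integrand** `(τ, w) ↦ χ(τ) ⟪R(τ)U(w), Ψ(R(τ)w + ξ(τ)) R(τ)U(w)⟫`. [folklore] -/
theorem integrable_rigid_quadratic (hUm : AEStronglyMeasurable U volume)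
    (hU2 : LocallyIntegrable (fun z => ‖U z‖ ^ 2) volume) (hξ : Continuous ξ) (hR : Continuous R)
    (hRi : ∀ τ w, ‖R τ w‖ = ‖w‖)
    {χ : ℝ → ℝ} (hχ : Continuous χ) (hχc : HasCompactSupport χ)
    {Ψ : EuclideanSpace ℝ (Fin 3) → EuclideanSpace ℝ (Fin 3) →L[ℝ] EuclideanSpace ℝ (Fin 3)} (hΨ : Continuous Ψ)
    (hΨc : HasCompactSupport Ψ) :
    Integrable (uncurry fun τ w => χ τ * ⟪R τ (U w), Ψ (R τ w + ξ τ) (R τ (U w))⟫)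
      ((volume : Measure ℝ).prod (volume : Measure (EuclideanSpace ℝ (Fin 3)))) := by
  obtain ⟨T, Cχ, hCχ0, hCχ, hχT⟩ := exists_bound_Icc_of_hasCompactSupport hχ hχc
  obtain ⟨CΨ, hCΨ⟩ := hΨ.bounded_above_of_compact_support hΨc
  have hCΨ0 : 0 ≤ CΨ := (norm_nonneg _).trans (hCΨ 0)
  obtain ⟨R₀, hR₀⟩ := hΨc.isCompact.isBounded.subset_closedBall (0 : EuclideanSpace ℝ (Fin 3))
  obtain ⟨M, hM⟩ := (isCompact_Icc (a := -T) (b := T)).exists_bound_of_continuousOn hξ.continuousOn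
  set K : Set (EuclideanSpace ℝ (Fin 3)) := closedBall 0 (R₀ + M) with hK
  have hKc : IsCompact K := isCompact_closedBall _ _
  set bound : ℝ × EuclideanSpace ℝ (Fin 3) → ℝ := fun p =>
    (Icc (-T) T).indicator (fun _ => Cχ) p.1 * K.indicator (fun z => CΨ * ‖U z‖ ^ 2) p.2 with hbound
  have hbi : Integrable bound ((volume : Measure ℝ).prod (volume : Measure (EuclideanSpace ℝ (Fin 3)))) := by
    refine Integrable.mul_prod ?_ ?_
    · rw [integrable_indicator_iff measurableSet_Icc]
      exact integrableOn_const (by rw [Real.volume_Icc]; exact ENNReal.ofReal_ne_top)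
    · rw [integrable_indicator_iff hKc.measurableSet]
      exact ((hU2.integrableOn_isCompact hKc).const_mul CΨ)
  have hmeas : AEStronglyMeasurable (uncurry fun τ w => χ τ * ⟪R τ (U w), Ψ (R τ w + ξ τ) (R τ (U w))⟫)
      ((volume : Measure ℝ).prod (volume : Measure (EuclideanSpace ℝ (Fin 3)))) := by
    have h1 : AEStronglyMeasurable (fun p : ℝ × EuclideanSpace ℝ (Fin 3) => U p.2)
        ((volume : Measure ℝ).prod (volume : Measure (EuclideanSpace ℝ (Fin 3)))) := hUm.comp_snd
    have happ := (isBoundedBilinearMap_apply (𝕜 := ℝ) (E := EuclideanSpace ℝ (Fin 3)) (F := EuclideanSpace ℝ (Fin 3))).continuous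
    have h1' : AEStronglyMeasurable (fun p : ℝ × EuclideanSpace ℝ (Fin 3) => R p.1 (U p.2))
        ((volume : Measure ℝ).prod (volume : Measure (EuclideanSpace ℝ (Fin 3)))) :=
      happ.comp_aestronglyMeasurable ((hR.comp continuous_fst).aestronglyMeasurable.prodMk h1)
    have h2 : Continuous fun p : ℝ × EuclideanSpace ℝ (Fin 3) => Ψ (R p.1 p.2 + ξ p.1) :=
      hΨ.comp (((hR.comp continuous_fst).clm_apply continuous_snd).add (hξ.comp continuous_fst))
    have h3 : AEStronglyMeasurable (fun p : ℝ × EuclideanSpace ℝ (Fin 3) => Ψ (R p.1 p.2 + ξ p.1) (R p.1 (U p.2)))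
        ((volume : Measure ℝ).prod (volume : Measure (EuclideanSpace ℝ (Fin 3)))) :=
      happ.comp_aestronglyMeasurable (h2.aestronglyMeasurable.prodMk h1')
    exact ((hχ.comp continuous_fst).aestronglyMeasurable).mul (h1'.inner h3)
  refine hbi.mono' hmeas (Eventually.of_forall fun p => ?_)
  simp only [uncurry, hbound]
  by_cases hτ : χ p.1 = 0
  · rw [hτ, zero_mul, norm_zero]
    exact mul_nonneg (indicator_nonneg (fun _ _ => hCχ0) _)
      (indicator_nonneg (fun z _ => mul_nonneg hCΨ0 (sq_nonneg _)) _)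
  have hτI : p.1 ∈ Icc (-T) T := hχT p.1 hτ
  rw [indicator_of_mem hτI]
  by_cases hz : p.2 ∈ K
  · rw [indicator_of_mem hz, norm_mul]
    refine mul_le_mul (hCχ _) ?_ (norm_nonneg _) hCχ0
    calc ‖⟪R p.1 (U p.2), Ψ (R p.1 p.2 + ξ p.1) (R p.1 (U p.2))⟫‖
        ≤ ‖R p.1 (U p.2)‖ * ‖Ψ (R p.1 p.2 + ξ p.1) (R p.1 (U p.2))‖ := norm_inner_le_norm _ _
      _ ≤ ‖U p.2‖ * (CΨ * ‖U p.2‖) := by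
          rw [hRi]
          gcongr
          exact (ContinuousLinearMap.le_opNorm _ _).trans (by rw [hRi]; exact mul_le_mul_of_nonneg_right (hCΨ _) (norm_nonneg _))
      _ = CΨ * ‖U p.2‖ ^ 2 := by ring
  · have hΨ0 : Ψ (R p.1 p.2 + ξ p.1) = 0 := by
      by_contra hne
      have h1 : ‖R p.1 p.2 + ξ p.1‖ ≤ R₀ := mem_closedBall_zero_iff.1 (hR₀ (subset_tsupport _ (mem_support.2 hne)))
      have h2 : ‖R p.1 p.2‖ ≤ ‖R p.1 p.2 + ξ p.1‖ + ‖ξ p.1‖ := norm_le_add_norm_add _ _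
      rw [hRi] at h2
      exact hz (mem_closedBall_zero_iff.2 (by linarith [hM p.1 hτI]))
    rw [hΨ0, zero_apply, inner_zero_right, mul_zero, norm_zero, indicator_of_notMem hz, mul_zero]

/-! ### Slice integrability -/

/-- `w ↦ ⟪L U(w), G(L′ w + c)⟫` is integrable (`U ∈ L¹_loc`, `L, L′ ∈ L(ℝ³)`, `L′` norm preserving, `G` continuous with compact support). [folklore] -/
theorem integrable_inner_rigid (hU : LocallyIntegrable U volume) (L : EuclideanSpace ℝ (Fin 3) →L[ℝ] EuclideanSpace ℝ (Fin 3))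
    {L' : EuclideanSpace ℝ (Fin 3) →L[ℝ] EuclideanSpace ℝ (Fin 3)} (hL' : ∀ w, ‖L' w‖ = ‖w‖)
    {G : EuclideanSpace ℝ (Fin 3) → EuclideanSpace ℝ (Fin 3)} (hG : Continuous G) (hGc : HasCompactSupport G)
    (c : EuclideanSpace ℝ (Fin 3)) : Integrable (fun w => ⟪L (U w), G (L' w + c)⟫) volume := by
  have hLU : LocallyIntegrable (fun w => L (U w)) volume := by
    have h := L.locallyIntegrableOn_comp (locallyIntegrableOn_univ.2 hU)
    exact locallyIntegrableOn_univ.1 h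
  refine integrable_inner_of_locallyIntegrable_of_hasCompactSupport hLU (hG.comp (L'.continuous.add continuous_const)) ?_
  obtain ⟨R₀, hR₀⟩ := hGc.isCompact.isBounded.subset_closedBall (0 : EuclideanSpace ℝ (Fin 3))
  refine HasCompactSupport.intro (isCompact_closedBall (0 : EuclideanSpace ℝ (Fin 3)) (R₀ + ‖c‖)) fun w hw => ?_
  by_contra hne
  have h1 : ‖L' w + c‖ ≤ R₀ := mem_closedBall_zero_iff.1 (hR₀ (subset_tsupport _ (mem_support.2 hne)))
  have h2 : ‖L' w‖ ≤ ‖L' w + c‖ + ‖c‖ := norm_le_add_norm_add _ _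
  rw [hL'] at h2
  exact hw (mem_closedBall_zero_iff.2 (by linarith))

/-- `w ↦ ⟪L U(w), Ψ(L′ w + c) (L U(w))⟫` is integrable (`|U|² ∈ L¹_loc`, `L, L′` norm preserving, `Ψ` a continuous compactly supported operator
field). [folklore] -/
theorem integrable_inner_clm_rigid_self (hUm : AEStronglyMeasurable U volume)
    (hU2 : LocallyIntegrable (fun z => ‖U z‖ ^ 2) volume) {L L' : EuclideanSpace ℝ (Fin 3) →L[ℝ] EuclideanSpace ℝ (Fin 3)}
    (hL : ∀ w, ‖L w‖ = ‖w‖) (hL' : ∀ w, ‖L' w‖ = ‖w‖)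
    {Ψ : EuclideanSpace ℝ (Fin 3) → EuclideanSpace ℝ (Fin 3) →L[ℝ] EuclideanSpace ℝ (Fin 3)} (hΨ : Continuous Ψ)
    (hΨc : HasCompactSupport Ψ) (c : EuclideanSpace ℝ (Fin 3)) :
    Integrable (fun w => ⟪L (U w), Ψ (L' w + c) (L (U w))⟫) volume := by
  obtain ⟨M₁, hM₁⟩ := hΨ.bounded_above_of_compact_support hΨc
  obtain ⟨R₀, hR₀⟩ := hΨc.isCompact.isBounded.subset_closedBall (0 : EuclideanSpace ℝ (Fin 3))
  set K : Set (EuclideanSpace ℝ (Fin 3)) := closedBall 0 (R₀ + ‖c‖) with hK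
  have hKc : IsCompact K := isCompact_closedBall _ _
  have hmeas : AEStronglyMeasurable (fun w => ⟪L (U w), Ψ (L' w + c) (L (U w))⟫) volume := by
    have h1 : AEStronglyMeasurable (fun w => L (U w)) volume := L.continuous.comp_aestronglyMeasurable hUm
    exact h1.inner ((isBoundedBilinearMap_apply (𝕜 := ℝ) (E := EuclideanSpace ℝ (Fin 3))
      (F := EuclideanSpace ℝ (Fin 3))).continuous.comp_aestronglyMeasurable
        ((hΨ.comp (L'.continuous.add continuous_const)).aestronglyMeasurable.prodMk h1))
  have hg : Integrable (fun w => M₁ * ‖K.indicator (fun w => ‖U w‖ ^ 2) w‖) volume :=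
    ((integrable_indicator_iff hKc.measurableSet).2 (hU2.integrableOn_isCompact hKc)).norm.const_mul M₁
  refine hg.mono' hmeas (Eventually.of_forall fun w => ?_)
  by_cases hw : w ∈ K
  · rw [indicator_of_mem hw, Real.norm_of_nonneg (sq_nonneg ‖U w‖)]
    calc ‖⟪L (U w), Ψ (L' w + c) (L (U w))⟫‖ ≤ ‖L (U w)‖ * ‖Ψ (L' w + c) (L (U w))‖ := norm_inner_le_norm _ _
      _ ≤ ‖U w‖ * (M₁ * ‖U w‖) := by
          rw [hL]
          gcongr
          exact (ContinuousLinearMap.le_opNorm _ _).trans (by rw [hL]; exact mul_le_mul_of_nonneg_right (hM₁ _) (norm_nonneg _))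
      _ = M₁ * ‖U w‖ ^ 2 := by ring
  · have hΨ0 : Ψ (L' w + c) = 0 := by
      by_contra hne
      have h1 : ‖L' w + c‖ ≤ R₀ := mem_closedBall_zero_iff.1 (hR₀ (subset_tsupport _ (mem_support.2 hne)))
      have h2 : ‖L' w‖ ≤ ‖L' w + c‖ + ‖c‖ := norm_le_add_norm_add _ _
      rw [hL'] at h2
      exact hw (mem_closedBall_zero_iff.2 (by linarith))
    rw [hΨ0, indicator_of_notMem hw]
    simp

end RigidFrame

end Summit.NavierStokesRegularity.NavierStokesRegularity.Theorems.PowerGaugeEulerLiouville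

end
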